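import Literature.Geometry.Riemannian.DistSqEndBarriers
import HarnessLib

/-!
# Auxiliary geometry for the directional datum of `d_t²` (Bamler 2020a, proof of Thm. 3.5):
# short radial geodesics, and the reversed geodesic with its `cos²`-weighted Ricci integral

For a complete Riemannian manifold and the geodesic `γ(s) = exp_p(su)` of a unit vector `u`:

* `edist_expMap_smul_toReal_le_abs` — `d(x, exp_x(σ v)) ≤ |σ|` for a unit vector `v` (length of
  the radial geodesic; no injectivity radius needed);
* `expMap_smul_neg_velocity_eq` — with `u′ = −γ̇(T)`: `exp_{γ(T)}(s u′) = γ(T − s)` (uniqueness of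
  geodesics), in particular `exp_{γ(T)}(T u′) = p`;
* `integral_sin_sq_ricci_reverse` — the `sin²`-weighted Ricci integral along the reversed geodesic
  is the `cos²`-weighted one along `γ`:
  `∫₀ᵀ sin²(πs/2T) Ric(γ̃̇(s), γ̃̇(s)) ds = ∫₀ᵀ cos²(πs/2T) Ric(γ̇(s), γ̇(s)) ds`, `γ̃(s) = γ(T − s)`.

These feed the two-ended assembly of the directional datum (`DistSqDirectionalDatum.lean`).
Everything is proved; no definitions, no named facts.

## References

* R. H. Bamler, *Entropy and heat kernel bounds on a Ricci flow background*, arXiv:2008.07093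
  (2020), §3.2, proof of Thm. 3.5. [Bamler2020Entropy]
-/

noncomputable section

open Bundle Set Function Filter MeasureTheory intervalIntegral
open scoped Manifold ContDiff Topology ENNReal NNReal Real

namespace Literature.Geometry.Riemannian

open Lorentzian Lorentzian.PseudoRiemannianMetric

section Aux

variable {E : Type*} [NormedAddCommGroup E] [NormedSpace ℝ E] [FiniteDimensional ℝ E]
  [CompleteSpace E] {M : Type*} [TopologicalSpace M] [ChartedSpace E M] [IsManifold 𝓘(ℝ, E) ∞ M]
  [T2Space M]
  (g : PseudoRiemannianMetric 𝓘(ℝ, E) ∞ E (TangentSpace 𝓘(ℝ, E) : M → Type _)) [g.HasLeviCivita]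
  [CovariantDerivative.ContMDiffCovariantDerivative g.leviCivita 1]
  [CovariantDerivative.ContMDiffCovariantDerivative g.leviCivita ∞]

/-- Smoothness and unit speed of the geodesic `s ↦ exp_x(s v)` of a unit vector `v` (complete
connection). [cite: LeeRiemannianManifolds2018, Prop. 5.19] -/
theorem contMDiff_and_unit_speed_expMap_smul (hc : IsGeodesicallyComplete g.leviCivita) (x : M)
    (v : TangentSpace 𝓘(ℝ, E) x) (hv : g.val x v v = 1) :
    ContMDiff 𝓘(ℝ, ℝ) 𝓘(ℝ, E) ∞ (fun s : ℝ ↦ expMap g.leviCivita x (s • v)) ∧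
      (expMap g.leviCivita x ((0 : ℝ) • v) = x) ∧
      ∀ s, g.val (expMap g.leviCivita x (s • v))
        (velocity 𝓘(ℝ, E) (fun s : ℝ ↦ expMap g.leviCivita x (s • v)) s)
        (velocity 𝓘(ℝ, E) (fun s : ℝ ↦ expMap g.leviCivita x (s • v)) s) = 1 := by
  haveI : Fact ((1 : ℕ∞ω) ≤ (∞ : ℕ∞ω)) := ⟨by exact_mod_cast le_top⟩
  set γ : ℝ → M := fun s ↦ expMap g.leviCivita x (s • v) with hγ_def
  have hgeo : IsGeodesic g.leviCivita γ := isGeodesic_expMap_smul_of_isGeodesicallyComplete hc x v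
  have hγfun : γ = maximalGeodesic g.leviCivita x v := funext fun t ↦ expMap_smul hc x v t
  have hγs : ContMDiff 𝓘(ℝ, ℝ) 𝓘(ℝ, E) ∞ γ := by
    rw [hγfun]
    exact (contMDiff_maximalGeodesic_family hc x).comp
      (contMDiff_id.prodMk (contMDiff_const (c := (show E from v))))
  have hγ0 : γ 0 = x := by
    show expMap g.leviCivita x ((0 : ℝ) • v) = x
    rw [zero_smul]; exact expMap_zero (cov := g.leviCivita) x
  have hspeed : ∀ s, g.val (γ s) (velocity 𝓘(ℝ, E) γ s) (velocity 𝓘(ℝ, E) γ s) = 1 := by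
    intro s
    have h := g.val_velocity_eq_of_isGeodesicOn_holds isOpen_univ ordConnected_univ hgeo
      (mem_univ s) (mem_univ 0)
    have hv0 : (velocity 𝓘(ℝ, E) γ 0 : E) = (v : E) := velocity_expMap_smul_zero x v
    rw [h, hv0, hγ0, hv]
  exact ⟨hγs, hγ0, hspeed⟩

/-- **`d(x, exp_x(σ v)) ≤ |σ|`** for a unit vector `v` (length of the radial geodesic of length
`|σ|`; the case `σ < 0` through `exp_x(σ v) = exp_x(|σ| (−v))`). [folklore] -/
theorem edist_expMap_smul_toReal_le_abs (hg : g.IsRiemannian) (hc : IsGeodesicallyComplete g.leviCivita)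
    (x : M) (v : TangentSpace 𝓘(ℝ, E) x) (hv : g.val x v v = 1) (σ : ℝ) :
    g.edist hg x (expMap g.leviCivita x (σ • v)) ≠ ⊤ ∧
      (g.edist hg x (expMap g.leviCivita x (σ • v))).toReal ≤ |σ| := by
  rcases le_or_gt 0 σ with hσ | hσ
  · obtain ⟨hγs, hγ0, hspeed⟩ := contMDiff_and_unit_speed_expMap_smul g hc x v hv
    have h := edist_toReal_le_of_unit_speed g hg hγs hσ hspeed
    rw [hγ0, abs_of_nonneg hσ] at *
    exact h
  · have hv' : g.val x (-v) (-v) = 1 := by simp [hv]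
    obtain ⟨hγs, hγ0, hspeed⟩ := contMDiff_and_unit_speed_expMap_smul g hc x (-v) hv'
    have h := edist_toReal_le_of_unit_speed g hg hγs (T' := -σ) (by linarith) hspeed
    rw [hγ0] at h
    simp only [smul_neg, neg_smul, neg_neg] at h
    rw [abs_of_neg hσ]
    exact h

/-- **The reversed geodesic from `γ(T)`**: for `γ(s) = exp_p(su)` and `u′ = −γ̇(T)`, `u′` is a
unit vector and `exp_{γ(T)}(s u′) = γ(T − s)` for all `s` (the curve `s ↦ γ(T − s)` is the
geodesic with initial data `(γ(T), −γ̇(T))`, `IsGeodesic.eq_maximalGeodesic`).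
[cite: LeeRiemannianManifolds2018, Prop. 5.19] -/
theorem expMap_smul_neg_velocity_eq (hc : IsGeodesicallyComplete g.leviCivita) (p : M)
    (u : TangentSpace 𝓘(ℝ, E) p) (hu : g.val p u u = 1) (T : ℝ) :
    g.val (expMap g.leviCivita p (T • u))
        (-velocity 𝓘(ℝ, E) (fun t : ℝ ↦ expMap g.leviCivita p (t • u)) T)
        (-velocity 𝓘(ℝ, E) (fun t : ℝ ↦ expMap g.leviCivita p (t • u)) T) = 1 ∧
      ∀ s : ℝ, expMap g.leviCivita (expMap g.leviCivita p (T • u))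
          (s • (-velocity 𝓘(ℝ, E) (fun t : ℝ ↦ expMap g.leviCivita p (t • u)) T)) =
        expMap g.leviCivita p ((T - s) • u) := by
  obtain ⟨hγs, hγ0, hspeed⟩ := contMDiff_and_unit_speed_expMap_smul g hc p u hu
  set γ : ℝ → M := fun s ↦ expMap g.leviCivita p (s • u) with hγ_def
  have hgeo : IsGeodesic g.leviCivita γ := isGeodesic_expMap_smul_of_isGeodesicallyComplete hc p u
  refine ⟨by simpa using hspeed T, fun s ↦ ?_⟩
  -- the reversed curve is a geodesic with initial data `(γ T, −γ̇ T)`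
  have hrev : IsGeodesic g.leviCivita (fun t ↦ γ (-1 * t + T)) := hgeo.comp_affine (-1) T
  have hv : velocity 𝓘(ℝ, E) (fun t ↦ γ (-1 * t + T)) 0 =
      cast (by rw [show (-1 : ℝ) * 0 + T = T by ring]) (-velocity 𝓘(ℝ, E) γ T) := by
    rw [velocity_comp_affine]
    refine (cast_eq_iff_heq.2 ?_).symm
    rw [show (-1 : ℝ) * 0 + T = T by ring, neg_one_smul]
  have hlift : tangentLift 𝓘(ℝ, E) (fun t ↦ γ (-1 * t + T)) 0 =
      (⟨γ T, -velocity 𝓘(ℝ, E) γ T⟩ : TangentBundle 𝓘(ℝ, E) M) := by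
    refine TotalSpace.ext (by simp) ?_
    show HEq (velocity 𝓘(ℝ, E) (fun t ↦ γ (-1 * t + T)) 0) (-velocity 𝓘(ℝ, E) γ T)
    rw [hv]
    exact cast_heq _ _
  have heq := hrev.eq_maximalGeodesic hlift
  have h1 : expMap g.leviCivita (γ T) (s • (-velocity 𝓘(ℝ, E) γ T)) =
      maximalGeodesic g.leviCivita (γ T) (-velocity 𝓘(ℝ, E) γ T) s := expMap_smul hc _ _ s
  show expMap g.leviCivita (γ T) (s • (-velocity 𝓘(ℝ, E) γ T)) = γ (T - s)
  rw [h1, ← congrFun heq s]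
  show γ (-1 * s + T) = γ (T - s)
  ring_nf

/-- **The `sin²`-weighted Ricci integral along the reversed geodesic is the `cos²`-weighted one
along `γ`** (`γ̃(s) = γ(T − s)`, `γ̃̇(s) = −γ̇(T − s)`, `Ric` is quadratic, and the substitution
`s ↦ T − s` with `sin(π(T − s)/2T) = cos(πs/2T)`). [folklore] -/
theorem integral_sin_sq_ricci_reverse (hc : IsGeodesicallyComplete g.leviCivita) (p : M)
    (u : TangentSpace 𝓘(ℝ, E) p) (hu : g.val p u u = 1) {T : ℝ} (hT : 0 < T) :
    ∫ s in (0 : ℝ)..T, Real.sin (π * s / (2 * T)) ^ 2 *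
        g.leviCivita.ricci (expMap g.leviCivita (expMap g.leviCivita p (T • u))
            (s • (-velocity 𝓘(ℝ, E) (fun t : ℝ ↦ expMap g.leviCivita p (t • u)) T)))
          (velocity 𝓘(ℝ, E) (fun s : ℝ ↦ expMap g.leviCivita (expMap g.leviCivita p (T • u))
            (s • (-velocity 𝓘(ℝ, E) (fun t : ℝ ↦ expMap g.leviCivita p (t • u)) T))) s)
          (velocity 𝓘(ℝ, E) (fun s : ℝ ↦ expMap g.leviCivita (expMap g.leviCivita p (T • u))
            (s • (-velocity 𝓘(ℝ, E) (fun t : ℝ ↦ expMap g.leviCivita p (t • u)) T))) s) =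
      ∫ s in (0 : ℝ)..T, Real.cos (π * s / (2 * T)) ^ 2 *
        g.leviCivita.ricci (expMap g.leviCivita p (s • u))
          (velocity 𝓘(ℝ, E) (fun t : ℝ ↦ expMap g.leviCivita p (t • u)) s)
          (velocity 𝓘(ℝ, E) (fun t : ℝ ↦ expMap g.leviCivita p (t • u)) s) := by
  obtain ⟨-, hrev⟩ := expMap_smul_neg_velocity_eq g hc p u hu T
  have _ := hT
  set γ : ℝ → M := fun s ↦ expMap g.leviCivita p (s • u) with hγ_def
  -- the reversed curve as a function
  have hfun : (fun s : ℝ ↦ expMap g.leviCivita (expMap g.leviCivita p (T • u))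
      (s • (-velocity 𝓘(ℝ, E) γ T))) = fun s ↦ γ (T - s) := funext fun s ↦ hrev s
  -- velocity of the reversed curve: `−γ̇(T − s)` (as vectors of `E`)
  have hvel : ∀ s : ℝ, (velocity 𝓘(ℝ, E) (fun s ↦ γ (T - s)) s : E) = -(velocity 𝓘(ℝ, E) γ (T - s) : E) := by
    intro s
    have h1 : velocity 𝓘(ℝ, E) (fun s ↦ γ (T - s)) s = velocity 𝓘(ℝ, E) (fun t ↦ (fun w ↦ γ (w + T)) (-t)) s :=
      (velocity_congr_of_forall (γ := fun s ↦ γ (T - s)) (γ' := fun t ↦ (fun w ↦ γ (w + T)) (-t))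
        (fun s ↦ by simp only; ring_nf) s).symm
    have h2 := velocity_reverse (I := 𝓘(ℝ, E)) (fun w ↦ γ (w + T)) s
    have h3 := velocity_translate (I := 𝓘(ℝ, E)) γ T (-s)
    have h4 : (velocity 𝓘(ℝ, E) γ (-s + T) : E) = velocity 𝓘(ℝ, E) γ (T - s) :=
      congrArg (fun a ↦ (velocity 𝓘(ℝ, E) γ a : E)) (by ring)
    rw [h1, h2, h3, ← h4]
    rfl
  have hvel' : ∀ s : ℝ, (velocity 𝓘(ℝ, E) (fun s : ℝ ↦ expMap g.leviCivita (expMap g.leviCivita p (T • u))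
      (s • (-velocity 𝓘(ℝ, E) γ T))) s : E) = -(velocity 𝓘(ℝ, E) γ (T - s) : E) := by
    intro s; rw [hfun]; exact hvel s
  -- congruence of `Ric(v, v)` under change of base point and `v = −w`
  have key : ∀ (a b : M) (hab : a = b) (v : TangentSpace 𝓘(ℝ, E) a) (w : TangentSpace 𝓘(ℝ, E) b),
      (v : E) = -(w : E) → g.leviCivita.ricci a v v = g.leviCivita.ricci b w w := by
    intro a b hab v w hvw
    subst hab
    have : v = -w := hvw
    rw [this]
    simp
  set R : ℝ → ℝ := fun w ↦ g.leviCivita.ricci (expMap g.leviCivita p (w • u))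
    (velocity 𝓘(ℝ, E) γ w) (velocity 𝓘(ℝ, E) γ w) with hR
  have hpt : ∀ s : ℝ, Real.sin (π * s / (2 * T)) ^ 2 *
      g.leviCivita.ricci (expMap g.leviCivita (expMap g.leviCivita p (T • u)) (s • (-velocity 𝓘(ℝ, E) γ T)))
        (velocity 𝓘(ℝ, E) (fun s : ℝ ↦ expMap g.leviCivita (expMap g.leviCivita p (T • u))
          (s • (-velocity 𝓘(ℝ, E) γ T))) s)
        (velocity 𝓘(ℝ, E) (fun s : ℝ ↦ expMap g.leviCivita (expMap g.leviCivita p (T • u))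
          (s • (-velocity 𝓘(ℝ, E) γ T))) s) =
      Real.sin (π * s / (2 * T)) ^ 2 * R (T - s) := by
    intro s
    rw [key _ _ (hrev s) _ (velocity 𝓘(ℝ, E) γ (T - s)) (hvel' s)]
  rw [intervalIntegral.integral_congr fun s _ ↦ hpt s]
  -- substitution `s ↦ T − s`
  have h1 : ∫ s in (0 : ℝ)..T, Real.sin (π * s / (2 * T)) ^ 2 * R (T - s) =
      ∫ s in (0 : ℝ)..T, (fun w ↦ Real.sin (π * (T - w) / (2 * T)) ^ 2 * R w) (T - s) := by
    refine intervalIntegral.integral_congr fun s _ ↦ ?_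
    show _ = Real.sin (π * (T - (T - s)) / (2 * T)) ^ 2 * R (T - s)
    rw [show T - (T - s) = s by ring]
  have h2 := intervalIntegral.integral_comp_sub_left
    (fun w ↦ Real.sin (π * (T - w) / (2 * T)) ^ 2 * R w) T (a := 0) (b := T)
  rw [sub_self, sub_zero] at h2
  show ∫ s in (0 : ℝ)..T, Real.sin (π * s / (2 * T)) ^ 2 * R (T - s) =
    ∫ s in (0 : ℝ)..T, Real.cos (π * s / (2 * T)) ^ 2 * R s
  rw [h1, h2]
  refine intervalIntegral.integral_congr fun w _ ↦ ?_
  show Real.sin (π * (T - w) / (2 * T)) ^ 2 * R w = Real.cos (π * w / (2 * T)) ^ 2 * R w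
  rw [show π * (T - w) / (2 * T) = π / 2 - π * w / (2 * T) by field_simp, Real.sin_pi_div_two_sub]

end Aux

end Literature.Geometry.Riemannian

end
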